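import Summits.CriticalPhenomena.PercolationContinuityZ3.Theorems.PercNearOneGluingNoHeavyLowerTailSahiSunflowerPetalChain
import Literature.Combinatorics.Sahi2008.FKG
import Mathlib.Tactic.Linarith
import HarnessLib

/-!
# `NoHeavyLowerTail` (crux stmt-CriticalPhenomena-4575), master-family line P2: FRONTIER TRANSFER — Sahi's `E_n` is antitone under adding to a
# member a point missed by another member; hence `C_n` (given `C_{<n}`) reduces to FRONTIER-TERMINAL families

Support file (seat `prim-masterthm-p2`, gen 4; `--supports stmt-CriticalPhenomena-4575`); no definition, no named fact, no sorry.  Memo SAHI-ROUTE.md §4.14.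
The mechanism behind the all-`m` sunflower hierarchy theorem (`…SahiSunflowerHierarchy`), isolated for ARBITRARY finite weighted sets / posets:

* **TRANSFER INEQUALITY** (`sahiE_insert_le`, any finite weighted set `(α, μ ≥ 0)`, any class `P` of sets): if every `P`-family of size `≤ n+1` has
  `E ≥ 0`, then for a `P`-family `W_0,…,W_{n+1}` and a point `z ∉ W_{l₀}` missed by at least one OTHER member `W_{i₁}`,
  `E_{n+2}(W[l₀ ↦ W_{l₀} ∪ {z}]) ≤ E_{n+2}(W)` — by multilinearity (`χ_{W ∪ z} = χ_W + χ_{z}`) and the sign lemma `Sun.sahiE_cons_nonpos_of_cell`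
  (the cell `{z}` is contained in or disjoint from every member).
* **POSET FORM** (`sahiE_upperSet_insert_le`): for a weight Sahi-positive of all orders `≤ n+1` on a finite partial order and up-sets `W_i`, adding to
  `W_{l₀}` a point missed by another member does not increase `E_{n+2}`; if `z` is a FRONTIER point of `W_{l₀}` (maximal non-member) the new family is
  again a family of up-sets (`isUpperSet_insert_of_frontier`).
* **TERMINAL REDUCTION** (`sahiE_setInd_nonneg_of_terminal`, `sahiPositive_of_terminal`, `sahiPositive_all_of_terminal`): call a family of up-sets
  FRONTIER-TERMINAL if every frontier point of every member lies in all the other members.  Given Sahi positivity of the orders `≤ n+1`, order `n+2`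
  holds iff `E_{n+2} ≥ 0` on the terminal `(n+2)`-families (descent: each non-terminal family admits a move that keeps up-sets, raises `Σ|W_i|`, and
  does not raise `E`).  In particular (`sahiPositive_three_iff_terminal`) for every FKG probability weight on a finite distributive lattice — e.g. every
  product measure, Kahn's setting — **`C_3` ⟺ `E_3 ≥ 0` for the frontier-terminal triples of up-sets** (`max(Aᶜ) ⊆ B ∩ C`, `max(Bᶜ) ⊆ A ∩ C`,
  `max(Cᶜ) ⊆ A ∩ B`); terminal families with proper members are automatically in the non-absorbing "hard core".
Census (seat, exact; code/frontier4.py, frontier5.py): `{0,1}^4`, generic `p`: all 804 440 unordered triples of up-sets, 4 582 745 frontier moves,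
0 increases of `E_3`; 1 165 terminal triples (454 with no trivial member); `{0,1}^5` sampled: 18 642 moves at `n = 3`, 11 193 at `n = 4`, 0 increases.
-/

namespace Summit.CriticalPhenomena.PercolationContinuityZ3.Theorems

namespace SahiFrontierTransfer

open Finset Function Literature.Combinatorics.Sahi2008

variable {α : Type*} [Fintype α] [DecidableEq α]

omit [Fintype α] in
/-- `χ_{insert z S} = χ_S + χ_{{z}}` for `z ∉ S`. [this work] -/
theorem setInd_insert {z : α} {S : Finset α} (h : z ∉ S) : setInd (insert z S) = setInd S + setInd ({z} : Finset α) := by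
  funext y
  by_cases hyz : y = z
  · subst hyz; simp [setInd_apply, h]
  · simp [setInd_apply, hyz]

omit [Fintype α] in
/-- The cell `{z}` is absorbed by `S` if `z ∈ S` and annihilated otherwise. [this work] -/
theorem setInd_mul_setInd_singleton (S : Finset α) (z : α) :
    setInd S * setInd ({z} : Finset α) = if z ∈ S then setInd ({z} : Finset α) else 0 := by
  funext y
  by_cases hyz : y = z
  · subst hyz; by_cases hz : y ∈ S <;> simp [setInd_apply, hz]
  · by_cases hz : z ∈ S <;> simp [setInd_apply, hz, hyz]

/-- **TRANSFER INEQUALITY.**  For a nonnegative weight, a class `P` of sets all of whose families of size `≤ n+1` have `E ≥ 0`, a `P`-family `W` and a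
point `z ∉ W_{l₀}` missed by another member `W_{i₁}`: adding `z` to `W_{l₀}` does not increase `E_{n+2}`. [this work] -/
theorem sahiE_insert_le {μ : α → ℝ} (hμ : ∀ y, 0 ≤ μ y) (P : Finset α → Prop) {n : ℕ}
    (hlow : ∀ k, k ≤ n + 1 → ∀ V : Fin k → Finset α, (∀ i, P (V i)) → 0 ≤ sahiE μ k (fun i => setInd (V i)))
    (W : Fin (n + 2) → Finset α) (hW : ∀ i, P (W i)) {z : α} {l₀ i₁ : Fin (n + 2)} (hl : l₀ ≠ i₁) (h0 : z ∉ W l₀) (h1 : z ∉ W i₁) :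
    sahiE μ (n + 2) (fun l => setInd (update W l₀ (insert z (W l₀)) l)) ≤ sahiE μ (n + 2) (fun l => setInd (W l)) := by
  set G : Fin (n + 2) → α → ℝ := fun l => setInd (W l) with hG
  have hnew : (fun l => setInd (update W l₀ (insert z (W l₀)) l)) = update G l₀ (G l₀ + setInd ({z} : Finset α)) := by
    funext l
    by_cases hl0 : l = l₀
    · subst hl0; rw [update_self, update_self, hG]; exact setInd_insert h0
    · rw [update_of_ne hl0, update_of_ne hl0]
  rw [hnew, sahiE_update_add, update_eq_self, SahiMeetTowerAll.sahiE_update_eq_sahiE_cons]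
  obtain ⟨k₁, hk₁⟩ := Fin.exists_succAbove_eq (Ne.symm hl)
  have hw : 0 ≤ ex μ (setInd ({z} : Finset α)) := ex_nonneg hμ fun y => setInd_nonneg _ _
  have key := SahiDeltaSystem.Sun.sahiE_cons_nonpos_of_cell μ (fun g => ∃ T : Finset α, P T ∧ g = setInd T)
    (setInd ({z} : Finset α)) hw n (l₀.removeNth G)
    (fun k => ⟨W (l₀.succAbove k), hW _, rfl⟩)
    (fun k => by
      rw [Fin.removeNth_apply, hG]; dsimp only
      rw [setInd_mul_setInd_singleton]
      by_cases hzk : z ∈ W (l₀.succAbove k)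
      · exact Or.inl (if_pos hzk)
      · exact Or.inr (if_neg hzk))
    ⟨k₁, by
      rw [Fin.removeNth_apply, hk₁, hG]; dsimp only
      rw [setInd_mul_setInd_singleton, if_neg h1]⟩
    (fun k hk g hg => by
      choose T hT using hg
      have hgT : g = fun i => setInd (T i) := funext fun i => (hT i).2
      rw [hgT]
      exact hlow k hk T fun i => (hT i).1)
  linarith

section Poset

variable [PartialOrder α]

/-- **FRONTIER MONOTONICITY on a poset.**  If the weight is Sahi-positive of every order `≤ n+1`, then for up-sets `W_i` and a point `z ∉ W_{l₀}` missed
by another member, adding `z` to `W_{l₀}` does not increase `E_{n+2}`. [this work] -/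
theorem sahiE_upperSet_insert_le {ν : α → ℝ} (hν0 : ∀ y, 0 ≤ ν y) {n : ℕ} (hlow : ∀ k, k ≤ n + 1 → SahiPositive ν k)
    (W : Fin (n + 2) → Finset α) (hW : ∀ i, IsUpperSet ((W i : Finset α) : Set α)) {z : α} {l₀ i₁ : Fin (n + 2)} (hl : l₀ ≠ i₁)
    (h0 : z ∉ W l₀) (h1 : z ∉ W i₁) :
    sahiE ν (n + 2) (fun l => setInd (update W l₀ (insert z (W l₀)) l)) ≤ sahiE ν (n + 2) (fun l => setInd (W l)) :=
  sahiE_insert_le hν0 (fun T => IsUpperSet ((T : Finset α) : Set α))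
    (fun k hk V hV => (sahiPositive_iff_indicators ν k).1 (hlow k hk) V hV) W hW hl h0 h1

omit [Fintype α] in
/-- Adding a FRONTIER point (a maximal non-member) to an up-set gives an up-set. [this work] -/
theorem isUpperSet_insert_of_frontier {U : Finset α} (hU : IsUpperSet ((U : Finset α) : Set α)) {z : α} (hz : ∀ y, z < y → y ∈ U) :
    IsUpperSet ((insert z U : Finset α) : Set α) := by
  intro x y hxy hx
  rw [Finset.mem_coe, Finset.mem_insert] at hx ⊢
  rcases hx with rfl | hx
  · rcases eq_or_lt_of_le hxy with rfl | hlt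
    · exact Or.inl rfl
    · exact Or.inr (hz y hlt)
  · exact Or.inr (Finset.mem_coe.1 (hU hxy (Finset.mem_coe.2 hx)))

/-- **TERMINAL REDUCTION (indicator form).**  If the orders `≤ n+1` hold and `E_{n+2} ≥ 0` for every FRONTIER-TERMINAL family of up-sets (every
frontier point of every member lies in all other members), then `E_{n+2} ≥ 0` for EVERY family of up-sets. [this work] -/
theorem sahiE_setInd_nonneg_of_terminal {ν : α → ℝ} (hν0 : ∀ y, 0 ≤ ν y) {n : ℕ} (hlow : ∀ k, k ≤ n + 1 → SahiPositive ν k)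
    (hterm : ∀ W : Fin (n + 2) → Finset α, (∀ i, IsUpperSet ((W i : Finset α) : Set α)) →
      (∀ i z, z ∉ W i → (∀ y, z < y → y ∈ W i) → ∀ j, j ≠ i → z ∈ W j) → 0 ≤ sahiE ν (n + 2) (fun i => setInd (W i))) :
    ∀ W : Fin (n + 2) → Finset α, (∀ i, IsUpperSet ((W i : Finset α) : Set α)) → 0 ≤ sahiE ν (n + 2) (fun i => setInd (W i)) := by
  -- descent on the total deficiency `d`, `(n+2)·|α| ≤ Σ |W_i| + d`
  suffices h : ∀ (d : ℕ) (W : Fin (n + 2) → Finset α), (n + 2) * Fintype.card α ≤ (∑ i, (W i).card) + d →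
      (∀ i, IsUpperSet ((W i : Finset α) : Set α)) → 0 ≤ sahiE ν (n + 2) (fun i => setInd (W i)) by
    intro W hW
    exact h ((n + 2) * Fintype.card α) W (by omega) hW
  intro d
  induction d with
  | zero =>
    intro W hd hW
    apply hterm W hW
    intro i z hz _ _ _
    -- every member is full, contradiction with `z ∉ W i`
    exfalso
    have hle : ∀ j, (W j).card ≤ Fintype.card α := fun j => Finset.card_le_univ _
    have hlt : (W i).card < Fintype.card α := Finset.card_lt_univ_of_notMem hz
    have hsum : ∑ j, (W j).card < ∑ _j : Fin (n + 2), Fintype.card α :=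
      Finset.sum_lt_sum (fun j _ => hle j) ⟨i, Finset.mem_univ _, hlt⟩
    rw [Finset.sum_const, Finset.card_univ, Fintype.card_fin, smul_eq_mul] at hsum
    omega
  | succ d ih =>
    intro W hd hW
    by_cases ht : ∀ i z, z ∉ W i → (∀ y, z < y → y ∈ W i) → ∀ j, j ≠ i → z ∈ W j
    · exact hterm W hW ht
    · push Not at ht
      obtain ⟨i, z, hz, hfront, j, hji, hzj⟩ := ht
      have hstep := sahiE_upperSet_insert_le hν0 hlow W hW (Ne.symm hji) hz hzj
      refine le_trans ?_ hstep
      apply ih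
      · -- the total size went up by one
        have hcard : ∑ l, (update W i (insert z (W i)) l).card = (∑ l, (W l).card) + 1 := by
          have hfun : (fun l => (update W i (insert z (W i)) l).card) = update (fun l => (W l).card) i ((W i).card + 1) := by
            funext l
            by_cases hl : l = i
            · subst hl; rw [update_self, update_self, Finset.card_insert_of_notMem hz]
            · rw [update_of_ne hl, update_of_ne hl]
          rw [show (∑ l, (update W i (insert z (W i)) l).card) = ∑ l, (fun l => (update W i (insert z (W i)) l).card) l from rfl,
            hfun, Finset.sum_update_of_mem (Finset.mem_univ i), Finset.sdiff_singleton_eq_erase,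
            ← Finset.add_sum_erase Finset.univ (fun l => (W l).card) (Finset.mem_univ i)]
          ring
        omega
      · intro l
        by_cases hl : l = i
        · subst hl; rw [update_self]; exact isUpperSet_insert_of_frontier (hW l) hfront
        · rw [update_of_ne hl]; exact hW l

/-- **TERMINAL REDUCTION.**  Orders `≤ n+1` and the terminal `(n+2)`-families give order `n+2`. [this work] -/
theorem sahiPositive_of_terminal {ν : α → ℝ} (hν0 : ∀ y, 0 ≤ ν y) {n : ℕ} (hlow : ∀ k, k ≤ n + 1 → SahiPositive ν k)
    (hterm : ∀ W : Fin (n + 2) → Finset α, (∀ i, IsUpperSet ((W i : Finset α) : Set α)) →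
      (∀ i z, z ∉ W i → (∀ y, z < y → y ∈ W i) → ∀ j, j ≠ i → z ∈ W j) → 0 ≤ sahiE ν (n + 2) (fun i => setInd (W i))) :
    SahiPositive ν (n + 2) :=
  (sahiPositive_iff_indicators ν (n + 2)).2 (sahiE_setInd_nonneg_of_terminal hν0 hlow hterm)

/-- **TERMINAL REDUCTION, all orders.**  A nonnegative weight on a finite poset is Sahi-positive of every order iff `E_{n} ≥ 0` on the
frontier-terminal families of up-sets of every size `n ≥ 2`. [this work] -/
theorem sahiPositive_all_iff_terminal {ν : α → ℝ} (hν0 : ∀ y, 0 ≤ ν y) :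
    (∀ n, SahiPositive ν n) ↔ ∀ (n : ℕ) (W : Fin (n + 2) → Finset α), (∀ i, IsUpperSet ((W i : Finset α) : Set α)) →
      (∀ i z, z ∉ W i → (∀ y, z < y → y ∈ W i) → ∀ j, j ≠ i → z ∈ W j) → 0 ≤ sahiE ν (n + 2) (fun i => setInd (W i)) := by
  constructor
  · intro h n W hW _
    exact (sahiPositive_iff_indicators ν (n + 2)).1 (h (n + 2)) W hW
  · intro hterm n
    induction n using Nat.strong_induction_on with
    | _ n ih =>
      rcases n with _ | _ | k
      · exact sahiPositive_zero ν
      · exact sahiPositive_one hν0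
      · exact sahiPositive_of_terminal hν0 (fun j hj => ih j (by omega)) (hterm k)

/-- **`C_3` ⟺ terminal triples**, for every FKG probability weight on a finite distributive lattice (orders `≤ 2` are FKG): Sahi positivity of order 3
holds iff `E_3(χ_A, χ_B, χ_C) ≥ 0` for the FRONTIER-TERMINAL triples of up-sets — every maximal non-member of each of `A, B, C` lies in the other two.
(Product measures on a finite Boolean lattice: Kahn's setting.) [this work] -/
theorem sahiPositive_three_iff_terminal {β : Type*} [DistribLattice β] [Fintype β] [DecidableEq β] {μ : β → ℝ} (hμ : IsFKGMeasure μ) :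
    SahiPositive μ 3 ↔ ∀ W : Fin 3 → Finset β, (∀ i, IsUpperSet ((W i : Finset β) : Set β)) →
      (∀ i z, z ∉ W i → (∀ y, z < y → y ∈ W i) → ∀ j, j ≠ i → z ∈ W j) → 0 ≤ sahiE μ 3 (fun i => setInd (W i)) := by
  constructor
  · intro h W hW _
    exact (sahiPositive_iff_indicators μ 3).1 h W hW
  · intro hterm
    exact sahiPositive_of_terminal hμ.nonneg (fun k hk => sahiPositive_of_le_two hμ (by omega)) hterm

end Poset

end SahiFrontierTransfer

end Summit.CriticalPhenomena.PercolationContinuityZ3.Theorems
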